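import Mathlib
import Summits.Ventures.PercRepro2.OneSidedBase
import Summits.Ventures.PercRepro2.SwGlue

/-!
# Row (SW) across a cut separating `l` from `{h, o}` (blind cell PercRepro2, night-4 g4, 2026-08-24;
NIGHT4-SIDE.md §5′ P2)

`l` on the first side, `h, o` on the second.  `o ∈ C_R(l)` forces the cut vertex `c` into `C_R(l)`,
hence `c ∉ C_R(h)`: the red cluster of `h` lives on the `h`-side.  Two classes by the status of
`c` in the blue cluster of `l`: in the core (the `h`-side configuration is in `Q(G₂; c, h, o)` —
apply (SW)(G₂)) and on the red side only (the `h`-side configuration is in `{o ∈ C_R(c), h ∉ C_R(c)}`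
— apply the ONE-SIDED REIMER DOMINATION `card_oneSided_cluster_le`, mine-2's two-cluster Reimer
mechanism (`OneSided.count_le`) with the cluster-of-`h` event in place of `b ∈ C_R(h)`, via Hall
`exists_oneSidedPerm`).  `sw_glue_sep_l`: (SW)(G₂; c, h, o) ⟹ (SW)(G; l, h, o).
-/

namespace Summit.Ventures.PercRepro2

namespace Glue

open Hull LocRows ReimerCube OneSided

open scoped Classical

variable {V : Type*}

section Reimer

variable {E : Type*} [Fintype E] [DecidableEq E] (ends : E → Sym2 V)

omit [Fintype E] in
/-- `{u ↔ o}` is increasing. -/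
lemma incr_carries_uo (u o : V) : Incr (fun S : Finset E => Carries ends S u o) :=
  fun _ _ hST hS => hS.mono hST

/-- The event `{C(h) ∈ 𝓥}` on the cube. -/
def evJ (h : V) (𝓥 : Set (Set V)) (S : Finset E) : Prop := cluster ends (ofFinset S) h ∈ 𝓥

/-- The event `{u ↮ h}` on the cube. -/
def evD (u h : V) (S : Finset E) : Prop := ¬ Carries ends S u h

omit [Fintype E] in
/-- `{C(h) ∈ 𝓥}` is increasing for an up-set `𝓥`. -/
lemma incr_evJ (h : V) {𝓥 : Set (Set V)} (h𝓥 : IsUpperSet 𝓥) : Incr (evJ ends h 𝓥) := by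
  intro S T hST hS
  exact h𝓥 (cluster_mono (ofFinset_mono hST) h) hS

omit [Fintype E] in
/-- `{u ↮ h}` is decreasing. -/
lemma decr_evD (u h : V) : Decr (evD ends u h) :=
  fun _ _ hST hT hS => hT (hS.mono hST)

/-- **One-sided Reimer domination, cube form**: for every up-set `𝓥`,
`#{o ∈ C_R(u), C_R(h) ∈ 𝓥, h ∉ C_R(u)} ≤ #{o ∈ C_R(u), C_B(h) ∈ 𝓥, h ∉ C_R(u)}` — the red witnesses of
`o ∈ C_R(u)` and of `C_R(h) ∈ 𝓥` (the `u`- and `h`-components) are disjoint when `h ∉ C_R(u)`. -/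
theorem count_le_cluster (u h o : V) {𝓥 : Set (Set V)} (h𝓥 : IsUpperSet 𝓥) :
    (Finset.univ.powerset.filter fun S : Finset E =>
        Carries ends S u o ∧ cluster ends (ofFinset S) h ∈ 𝓥 ∧ ¬ Carries ends S u h).card ≤
      (Finset.univ.powerset.filter fun S : Finset E =>
        Carries ends S u o ∧ cluster ends (blue (ofFinset S)) h ∈ 𝓥 ∧ ¬ Carries ends S u h).card := by
  calc (Finset.univ.powerset.filter fun S : Finset E =>
        Carries ends S u o ∧ cluster ends (ofFinset S) h ∈ 𝓥 ∧ ¬ Carries ends S u h).card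
      ≤ (Finset.univ.powerset.filter fun S : Finset E =>
          DOcc (fun S => Carries ends S u o) (evJ ends h 𝓥) S ∧ evD ends u h S).card := by
        apply Finset.card_le_card
        intro S hS
        simp only [Finset.mem_filter, Finset.mem_powerset] at hS ⊢
        obtain ⟨hSU, hAS, hJS, hDS⟩ := hS
        refine ⟨hSU, ⟨sComp ends S u, sComp ends S h, sComp_subset ends S u, sComp_subset ends S h,
          disjoint_sComp_of_not_carries hDS, ?_, ?_⟩, hDS⟩
        · intro T hT
          exact (carries_sComp hAS).mono hT
        · intro T hT
          refine h𝓥 ?_ hJS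
          intro x hx
          rw [mem_cluster] at hx ⊢
          exact (carries_sComp hx).mono hT
    _ ≤ (Finset.univ.powerset.filter fun S : Finset E =>
          Carries ends S u o ∧ evJ ends h 𝓥 (Finset.univ \ S) ∧ evD ends u h S).card :=
        reimer_decreasing Finset.univ (fun S => Carries ends S u o) (evJ ends h 𝓥) (evD ends u h)
          (incr_carries_uo ends u o) (incr_evJ ends h h𝓥) (decr_evD ends u h)
    _ = _ := by
        congr 1; ext S
        simp only [Finset.mem_filter, evJ, evD, ofFinset_sdiff]

/-- **One-sided Reimer domination** (configurations): for every up-set `𝓥`,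
`#{o ∈ C_R(u), h ∉ C_R(u), C_R(h) ∈ 𝓥} ≤ #{o ∈ C_R(u), h ∉ C_R(u), C_B(h) ∈ 𝓥}`. -/
theorem card_oneSided_cluster_le (u h o : V) {𝓥 : Set (Set V)} (h𝓥 : IsUpperSet 𝓥) :
    (Finset.univ.filter fun ζ : Config E =>
        (o ∈ cluster ends ζ u ∧ h ∉ cluster ends ζ u) ∧ cluster ends ζ h ∈ 𝓥).card ≤
      (Finset.univ.filter fun ζ : Config E =>
        (o ∈ cluster ends ζ u ∧ h ∉ cluster ends ζ u) ∧ cluster ends (blue ζ) h ∈ 𝓥).card := by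
  rw [card_filter_eq_card_powerset_filter, card_filter_eq_card_powerset_filter]
  have key := count_le_cluster ends u h o h𝓥
  refine le_of_le_of_eq (le_of_eq_of_le ?_ key) ?_
  · congr 1; ext S
    simp only [Finset.mem_filter, Finset.mem_powerset, mem_cluster, Carries]; tauto
  · congr 1; ext S
    simp only [Finset.mem_filter, Finset.mem_powerset, mem_cluster, Carries]; tauto

/-- `{o ∈ C_R(u), h ∉ C_R(u)}` as a Finset. -/
noncomputable def oneSidedSet (u h o : V) : Finset (Config E) :=
  Finset.univ.filter fun ζ => o ∈ cluster ends ζ u ∧ h ∉ cluster ends ζ u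

/-- **The one-sided permutation** (Hall): an injection of `{o ∈ C_R(u), h ∉ C_R(u)}` into itself
carrying `C_R(h)` into `C_B(h)` of the image. -/
theorem exists_oneSidedPerm (u h o : V) :
    ∃ χ : {ζ // ζ ∈ oneSidedSet ends u h o} → Config E, Function.Injective χ ∧
      ∀ y, χ y ∈ oneSidedSet ends u h o ∧ cluster ends y.1 h ⊆ cluster ends (blue (χ y)) h := by
  let t : {ζ // ζ ∈ oneSidedSet ends u h o} → Finset (Config E) := fun y =>
    (oneSidedSet ends u h o).filter fun ζ' => cluster ends y.1 h ⊆ cluster ends (blue ζ') h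
  have hall : ∀ s : Finset {ζ // ζ ∈ oneSidedSet ends u h o}, s.card ≤ (s.biUnion t).card := by
    intro s
    let 𝓥 : Set (Set V) := {S | ∃ y ∈ s, cluster ends y.1 h ⊆ S}
    have h𝓥 : IsUpperSet 𝓥 := by
      intro S S' hSS' ⟨y, hy, hyS⟩
      exact ⟨y, hy, hyS.trans hSS'⟩
    have e1 : s.biUnion t = Finset.univ.filter fun ζ : Config E =>
        (o ∈ cluster ends ζ u ∧ h ∉ cluster ends ζ u) ∧ cluster ends (blue ζ) h ∈ 𝓥 := by
      ext ζ'
      simp only [Finset.mem_biUnion, Finset.mem_filter, t, 𝓥, Set.mem_setOf_eq, oneSidedSet,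
        Finset.mem_univ, true_and]
      constructor
      · rintro ⟨y, hy, h1, hsub⟩
        exact ⟨h1, y, hy, hsub⟩
      · rintro ⟨h1, y, hy, hsub⟩
        exact ⟨y, hy, h1, hsub⟩
    have e2 : s.card ≤ (Finset.univ.filter fun ζ : Config E =>
        (o ∈ cluster ends ζ u ∧ h ∉ cluster ends ζ u) ∧ cluster ends ζ h ∈ 𝓥).card := by
      refine Finset.card_le_card_of_injOn (fun y => y.1) ?_ ?_
      · intro y hy
        rw [Finset.mem_coe] at hy
        have hy1 := y.2
        simp only [oneSidedSet, Finset.mem_filter, Finset.mem_univ, true_and] at hy1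
        simp only [Finset.mem_coe, Finset.mem_filter, Finset.mem_univ, true_and]
        exact ⟨hy1, y, hy, subset_rfl⟩
      · intro x _ y _ hxy
        exact Subtype.ext hxy
    rw [e1]
    refine Nat.le_trans e2 ?_
    convert card_oneSided_cluster_le ends u h o h𝓥 using 4
  obtain ⟨f, hf, hft⟩ := (Finset.all_card_le_biUnion_card_iff_exists_injective t).1 hall
  refine ⟨f, hf, fun y => ?_⟩
  have := hft y
  simp only [t, Finset.mem_filter] at this
  exact this

end Reimer

section CutP2

variable {E₁ E₂ : Type*} {ends₁ : E₁ → Sym2 V} {ends₂ : E₂ → Sym2 V} {c : V} {V₁ V₂ : Set V}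

variable [Fintype E₁] [Fintype E₂] [DecidableEq E₁] [DecidableEq E₂]

/-- **(SW) across a cut separating `l` from `{h, o}`**: (SW) on the `{h, o}`-side with the cut
vertex as the root gives (SW) on the glued graph. -/
theorem sw_glue_sep_l {l h o : V} (hg : IsGluing ends₁ ends₂ c V₁ V₂) (hl : l ∈ V₁) (hh : h ∈ V₂)
    (hhc : h ≠ c) (ho : o ∈ V₂) (hoc : o ≠ c) (h₂ : Sw ends₂ c h o) :
    Sw (glue ends₁ ends₂) l h o := by
  obtain ⟨φ, hφ, hmemφ⟩ := h₂
  obtain ⟨χ, hχ, hmemχ⟩ := exists_oneSidedPerm ends₂ c h o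
  -- membership in `Q(G)`
  have key : ∀ ζ : Config (E₁ ⊕ E₂),
      ζ ∈ tgtU (glue ends₁ ends₂) l h {S : Set V | o ∈ S} ↔
        (¬ (c ∈ cluster ends₁ (ζ ∘ Sum.inl) l ∧ h ∈ cluster ends₂ (ζ ∘ Sum.inr) c) ∧
          ¬ (c ∈ cluster ends₁ (blue (ζ ∘ Sum.inl)) l ∧ h ∈ cluster ends₂ (blue (ζ ∘ Sum.inr)) c)) ∧
          (c ∈ cluster ends₁ (ζ ∘ Sum.inl) l ∧ o ∈ cluster ends₂ (ζ ∘ Sum.inr) c) ∧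
          ¬ (c ∈ cluster ends₁ (blue (ζ ∘ Sum.inl)) l ∧ o ∈ cluster ends₂ (blue (ζ ∘ Sum.inr)) c) := by
    intro ζ
    rw [mem_tgtU_glue_iff, mem_cluster_glue_iff_across hg hl hh hhc,
      mem_cluster_glue_iff_across hg hl hh hhc, mem_cluster_glue_iff_across hg hl ho hoc,
      mem_cluster_glue_iff_across hg hl ho hoc, blue_comp_inl, blue_comp_inr]
  -- membership in `Q(G₂; c, h, o)`
  have key₂ : ∀ ζ₂ : Config E₂,
      ζ₂ ∈ tgtU ends₂ c h {S : Set V | o ∈ S} ↔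
        (h ∉ cluster ends₂ ζ₂ c ∧ h ∉ cluster ends₂ (blue ζ₂) c) ∧
          o ∈ cluster ends₂ ζ₂ c ∧ o ∉ cluster ends₂ (blue ζ₂) c := by
    intro ζ₂
    simp only [tgtU, Finset.mem_filter, Finset.mem_univ, true_and, mem_hull_iff, Set.mem_setOf_eq,
      not_or]
  -- the core class lies in `Q(G₂; c, h, o)`, the red class in the one-sided set
  have pK : ∀ x : {ζ // ζ ∈ tgtU (glue ends₁ ends₂) l h {S : Set V | o ∈ S}},
      c ∈ cluster ends₁ (blue (x.1 ∘ Sum.inl)) l → x.1 ∘ Sum.inr ∈ tgtU ends₂ c h {S : Set V | o ∈ S} := by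
    intro x hB
    obtain ⟨⟨h1, h2⟩, ⟨h3, h4⟩, h5⟩ := (key x.1).1 x.2
    exact (key₂ _).2 ⟨⟨fun h' => h1 ⟨h3, h'⟩, fun h' => h2 ⟨hB, h'⟩⟩, h4, fun h' => h5 ⟨hB, h'⟩⟩
  have pR : ∀ x : {ζ // ζ ∈ tgtU (glue ends₁ ends₂) l h {S : Set V | o ∈ S}},
      x.1 ∘ Sum.inr ∈ oneSidedSet ends₂ c h o := by
    intro x
    obtain ⟨⟨h1, _⟩, ⟨h3, h4⟩, _⟩ := (key x.1).1 x.2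
    simp only [oneSidedSet, Finset.mem_filter, Finset.mem_univ, true_and]
    exact ⟨h4, fun h' => h1 ⟨h3, h'⟩⟩
  -- on `Q(G)` the red cluster of `h` lives on the `h`-side
  have hT : ∀ ζ : Config (E₁ ⊕ E₂), ζ ∈ tgtU (glue ends₁ ends₂) l h {S : Set V | o ∈ S} →
      cluster (glue ends₁ ends₂) ζ h = cluster ends₂ (ζ ∘ Sum.inr) h := by
    intro ζ hζ
    obtain ⟨⟨h1, _⟩, ⟨h3, _⟩, _⟩ := (key ζ).1 hζ
    rw [cluster_glue_eq₂ hg hh]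
    ext u
    simp only [Set.mem_union, Set.mem_setOf_eq]
    constructor
    · rintro (hu | ⟨hc, _⟩)
      · exact hu
      · exact absurd ⟨h3, mem_cluster_comm.1 hc⟩ h1
    · exact Or.inl
  refine ⟨fun x => if hB : c ∈ cluster ends₁ (blue (x.1 ∘ Sum.inl)) l
      then pair (x.1 ∘ Sum.inl) (φ ⟨x.1 ∘ Sum.inr, pK x hB⟩)
      else pair (x.1 ∘ Sum.inl) (χ ⟨x.1 ∘ Sum.inr, pR x⟩), ?_, ?_⟩
  · -- injective: the first side is kept, so the class is kept
    intro x y hxy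
    simp only at hxy
    have h1 := congrArg (fun ζ => ζ ∘ Sum.inl) hxy
    by_cases hx : c ∈ cluster ends₁ (blue (x.1 ∘ Sum.inl)) l <;>
      by_cases hy : c ∈ cluster ends₁ (blue (y.1 ∘ Sum.inl)) l
    · rw [dif_pos hx, dif_pos hy] at hxy h1
      simp only [pair_inl] at h1
      have h2 := congrArg (fun ζ => ζ ∘ Sum.inr) hxy
      simp only [pair_inr] at h2
      have h2' : x.1 ∘ Sum.inr = y.1 ∘ Sum.inr := congrArg Subtype.val (hφ h2)
      apply Subtype.ext
      rw [← pair_comp x.1, ← pair_comp y.1, h1, h2']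
    · rw [dif_pos hx, dif_neg hy] at h1
      simp only [pair_inl] at h1
      rw [h1] at hx
      exact absurd hx hy
    · rw [dif_neg hx, dif_pos hy] at h1
      simp only [pair_inl] at h1
      rw [h1] at hx
      exact absurd hy hx
    · rw [dif_neg hx, dif_neg hy] at hxy h1
      simp only [pair_inl] at h1
      have h2 := congrArg (fun ζ => ζ ∘ Sum.inr) hxy
      simp only [pair_inr] at h2
      have h2' : x.1 ∘ Sum.inr = y.1 ∘ Sum.inr := congrArg Subtype.val (hχ h2)
      apply Subtype.ext
      rw [← pair_comp x.1, ← pair_comp y.1, h1, h2']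
  · intro x
    obtain ⟨⟨h1, h2⟩, ⟨h3, h4⟩, h5⟩ := (key x.1).1 x.2
    by_cases hB : c ∈ cluster ends₁ (blue (x.1 ∘ Sum.inl)) l
    · -- the core class: (SW) on the `h`-side
      simp only [dif_pos hB]
      obtain ⟨ht, hsub⟩ := hmemφ ⟨x.1 ∘ Sum.inr, pK x hB⟩
      obtain ⟨⟨h1', h2'⟩, h3', h4'⟩ := (key₂ _).1 ht
      refine ⟨(key _).2 ?_, ?_⟩
      · rw [pair_inl, pair_inr]
        exact ⟨⟨fun h' => h1' h'.2, fun h' => h2' h'.2⟩, ⟨h3, h3'⟩, fun h' => h4' h'.2⟩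
      · rw [hT x.1 x.2, cluster_glue_eq₂ hg hh, blue_pair, pair_inr]
        exact fun u hu => Or.inl (hsub hu)
    · -- the red class: the one-sided Reimer permutation
      simp only [dif_neg hB]
      obtain ⟨ht, hsub⟩ := hmemχ ⟨x.1 ∘ Sum.inr, pR x⟩
      simp only [oneSidedSet, Finset.mem_filter, Finset.mem_univ, true_and] at ht
      refine ⟨(key _).2 ?_, ?_⟩
      · rw [pair_inl, pair_inr]
        exact ⟨⟨fun h' => ht.2 h'.2, fun h' => hB h'.1⟩, ⟨h3, ht.1⟩, fun h' => hB h'.1⟩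
      · rw [hT x.1 x.2, cluster_glue_eq₂ hg hh, blue_pair, pair_inr]
        exact fun u hu => Or.inl (hsub hu)

end CutP2

end Glue

end Summit.Ventures.PercRepro2
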